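import Literature.AlgebraicGeometry.Frobenioids.UnitTrivializationModelComparison
import Literature.AlgebraicGeometry.Frobenioids.Prop53SubIotaOverBase
import HarnessLib

/-!
# Frobenioids I, Prop. 5.3: the comparison equivalence `C^un-tr ≌ untrModel F` lies over `D`, and the
# natural functor `ι : C^istr → C^rlf` lies over `D` (row P53/L05c')

Mochizuki, *The geometry of Frobenioids I: the general theory*, Kyushu J. Math. **62** (2008) 293–400,
§5, Prop. 5.3 p. 103 ll. 16–30 [cite: MochizukiFrdI2008, Prop. 5.3 p.103] ("`C^un-tr` … may be obtained as
the model Frobenioid associated to … `Φ` … and … `Φ^birat`"; the 1-commutative diagram whose vertical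
arrows `C^istr → C^un-tr → … → C^rlf` are "the natural functors"), Cor. 5.4 p. 104 l. 5 ("the vertical
arrows are the natural functors of Proposition 5.3").

Proof-only companion of `UnitTrivializationModelComparison.lean` (seat abc-iut-L1-d5:
`exists_untr_comparison`).  The rows P53/L05c', C54/L06, C54/L08, C54/L09 of the sub-DAG
`plan/L1/SUBDAG-FrdI-Prop53-Cor54.md` (seat abc-iut-w5-d137) are parametrised by an equivalence
`e : C^un-tr ≌ untrModel F` lying over `D`; here:

* `exists_untr_comparison_overBase` — there is an equivalence `e : C^un-tr ≌ untrModel F` compatible with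
  the functors to `F_Φ` AND lying over `D` (`C^istr → C^un-tr ≌ untrModel F → D ≅ C^istr ⊆ C → D`; from
  the `F_Φ`-compatibility, since `untrModel F → F_Φ → D` is the base projection and
  `C^istr → C^un-tr → F_Φ = C^istr ⊆ C → F_Φ` on the nose, Prop. 3.3 (iv));
* `FrdI.Prop53Sub.exists_iotaRlf_baseIso` — hence (row P53/L05c', whose slot closer
  `FrdI.Prop53Sub.iotaRlfOverBase_holds` is seat abc-iut-L1-d2's `Prop53SubIotaOverBase.lean`, consumed by
  name: `untrToRlf : untrModel F → C^rlf` is the identity on base objects and base arrows) for some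
  comparison equivalence `e` THE natural functor `ι = iotaRlf F hΦ e : C^istr → C^rlf` lies over `D`.

Honest framing: kernel bookkeeping for a 2008 published statement ([FrdI]); proof-only (no `def`); nothing
here bears on [IUTchIII] Cor. 3.12.  Seat abc-iut-L1-d5 (gen 3; v2 filed by gen 4 after the gen-3 file
p417550 met a name already landed by seat abc-iut-L1-d2 — that declaration is now imported, not re-declared).
-/

namespace Literature.AlgebraicGeometry.Frobenioids

open CategoryTheory Opposite

universe w v v' u u'

namespace PreFrobenioid

variable {D : Type u} [Category.{v} D] {Φ : Dᵒᵖ ⥤ CommMonCat.{w}}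
  {C : Type u'} [Category.{v'} C] (F : C ⥤ ElemFrobenioid Φ)

open PreFrobenioidData (ofFunctor)

/-- The base projection of a model Frobenioid IS the base projection of its structure functor to `F_Φ`
(both read `(A_D, α) ↦ A_D`, `φ ↦ Base(φ)`). [cite: MochizukiFrdI2008, Thm. 5.2 (i) p.100] -/
theorem modelFrobenioid_baseFunctor_eq {B : Dᵒᵖ ⥤ CommMonCat.{w}} (DivB : B ⟶ monoidGp Φ) :
    ModelFrobenioid.baseFunctor Φ B DivB = baseFunctor (ModelFrobenioid.toElem Φ B DivB) := rfl

/-- An equivalence `C^un-tr ≌ untrModel F` compatible with the functors to `F_Φ` lies over `D`: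
`C^istr → C^un-tr ≌ untrModel F → D ≅ C^istr ⊆ C → D`. [cite: MochizukiFrdI2008, Prop. 5.3 p.103] -/
theorem toUntr_comp_baseIso_of_compToElem (hF : IsFrobenioid F)
    (e : (ofFunctor Φ F).Untr ≌ untrModel F)
    (he : e.functor ⋙ ModelFrobenioid.toElem Φ (biratSubfunctor F).toMonoid (biratSubfunctor F).incl ≅
      untrFunctor hF) :
    Nonempty ((ofFunctor Φ F).toUntr ⋙ e.functor ⋙
        ModelFrobenioid.baseFunctor Φ (biratSubfunctor F).toMonoid (biratSubfunctor F).incl ≅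
      (ofFunctor Φ F).istrι ⋙ baseFunctor F) := by
  have h : ((ofFunctor Φ F).toUntr ⋙ untrFunctor hF) ⋙ ElemFrobenioid.baseFunctor Φ =
      ((ofFunctor Φ F).istrι ⋙ F) ⋙ ElemFrobenioid.baseFunctor Φ := by
    rw [toUntr_comp_untrFunctor]
  exact ⟨Functor.isoWhiskerLeft (ofFunctor Φ F).toUntr
      (Functor.isoWhiskerRight he (ElemFrobenioid.baseFunctor Φ)) ≪≫ eqToIso h⟩

/-- **There is a comparison equivalence `e : C^un-tr ≌ untrModel F` compatible with the functors to `F_Φ`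
and lying over `D`** (Prop. 5.3 / Thm. 5.2 (iv) at `C^un-tr`). [cite: MochizukiFrdI2008, Prop. 5.3 p.103] -/
theorem exists_untr_comparison_overBase (hF : IsFrobenioid F) :
    ∃ e : (ofFunctor Φ F).Untr ≌ untrModel F,
      Nonempty (e.functor ⋙ ModelFrobenioid.toElem Φ (biratSubfunctor F).toMonoid (biratSubfunctor F).incl ≅
          untrFunctor hF) ∧
        Nonempty ((ofFunctor Φ F).toUntr ⋙ e.functor ⋙
            ModelFrobenioid.baseFunctor Φ (biratSubfunctor F).toMonoid (biratSubfunctor F).incl ≅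
          (ofFunctor Φ F).istrι ⋙ baseFunctor F) := by
  obtain ⟨E, hE, ⟨i⟩⟩ := exists_untr_comparison F hF
  letI := hE
  exact ⟨E.asEquivalence, ⟨i ≪≫ (untrFunctor hF).rightUnitor⟩,
    toUntr_comp_baseIso_of_compToElem F hF E.asEquivalence (i ≪≫ (untrFunctor hF).rightUnitor)⟩

end PreFrobenioid

/-! ### The natural functor `ι : C^istr → C^rlf` lies over `D` (row P53/L05c') -/

namespace FrdI.Prop53Sub

variable {D : Type u} [Category.{v} D] {Φ : Dᵒᵖ ⥤ CommMonCat.{w}}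
  {C : Type u'} [Category.{v'} C] (F : C ⥤ ElemFrobenioid Φ)

open PreFrobenioidData (ofFunctor)

/-- **THE natural functor `ι : C^istr → C^rlf` of Prop. 5.3 lies over `D`**, for a comparison equivalence
`e` compatible with the functors to `F_Φ` (which exists, `exists_untr_comparison_overBase`).
[cite: MochizukiFrdI2008, Prop. 5.3 p.103] -/
theorem exists_iotaRlf_baseIso (hF : PreFrobenioid.IsFrobenioid F) (hΦ : PreFrobenioid.IsPerfFactorialOn Φ) :
    ∃ e : (ofFunctor Φ F).Untr ≌ PreFrobenioid.untrModel F,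
      Nonempty (e.functor ⋙ ModelFrobenioid.toElem Φ (PreFrobenioid.biratSubfunctor F).toMonoid
          (PreFrobenioid.biratSubfunctor F).incl ≅ PreFrobenioid.untrFunctor hF) ∧
        Nonempty (iotaRlf F hΦ e ⋙ ModelFrobenioid.baseFunctor _ _ _ ≅
          (ofFunctor Φ F).istrι ⋙ PreFrobenioid.baseFunctor F) := by
  obtain ⟨e, hc, hb⟩ := PreFrobenioid.exists_untr_comparison_overBase F hF
  exact ⟨e, hc, iotaRlfOverBase_holds F hΦ e hb⟩

end FrdI.Prop53Sub

end Literature.AlgebraicGeometry.Frobenioids
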